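import Summits.Ventures.LatticeQCDFlow.Exactness.Phi4HMCPolyObs
import HarnessLib

/-!
# The HMC-type update on polynomial-envelope observables: reversibility and `L²` contraction without boundedness

HONEST FRAMING: exact (Metropolis-corrected) sampling algorithms for lattice gauge theory;
figures of merit are autocorrelation/cost numbers at stated couplings and volumes; no
continuum-physics claim.  (SCALAR calibration rung S0-A: not a gauge result.)

Venture `LatticeQCDFlow` (cell pub-lqcd), topic `Exactness`; FANOUT row 2 (`s0-phi4`, HMC arm).
NEW WORK of the cell, completing `Phi4HMCPolyObs` ((int), (stab), (lin) of the class `PolyObs`) with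
(symm) and (contr): an `L²` form of the involutive-Metropolis self-adjointness in which the
boundedness of the tree's `involOp_symm` is replaced by the AM–GM majorant
`|g∘Ψ| |h| min(e^{−H}, e^{−H∘Ψ}) ≤ ½((g∘Ψ)² e^{−H∘Ψ} + h² e^{−H})`, and Jensen against the momentum
law for square-integrable integrands.  Nothing is cited as a fact.

## What is proved

* `abs_involAccept_comp_mul_le`, `integrable_involAccept_comp_mul_mul`,
  `integrable_one_sub_involAccept_mul_mul`, **`involOp_symm_sq`** —
  `∫ (involOp H Ψ g) h e^{−H} = ∫ g (involOp H Ψ h) e^{−H}` for measurable `g, h` with `g² e^{−H}`,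
  `h² e^{−H}` integrable (general measurable space, `Ψ` a measure-preserving involution);
* `integrable_sq_fst_mul_exp_neg`, `hmcOpOf_pairing_poly`, **`hmc_reversible_poly`** — (symm) on
  `PolyObs`, for EVERY measurable Lebesgue-preserving involution (no growth hypothesis);
* `sq_integral_le_of_sq_integrable` (Cauchy–Schwarz against `e^{−½Σp²}` for square-integrable `u`),
  `hmcOpOf_sq_le_poly`, **`hmcOpOf_contraction_poly`** — (contr) on `PolyObs` (growth hypothesis
  `s(Ψ z) ≤ C s(z)^m`, which makes `K_Ψ f` polynomially bounded).

The floors for `S` and `M` themselves are `Exactness/Phi4HMCPolyObsFloor.lean`.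
-/

namespace Summit.Ventures.LatticeQCDFlow.Exactness

open Real MeasureTheory Filter Finset
open Summit.Ventures.LatticeQCDFlow.Scoring

/-! ## Self-adjointness of the involutive Metropolis step for square-integrable observables -/

section General

variable {X : Type*} [MeasurableSpace X] {μ : Measure X}

omit [MeasurableSpace X] in
/-- AM–GM majorant of the move term: `|a g(Ψ z) h(z)| e^{−H z} ≤ ½ (g(Ψ z)² e^{−H(Ψ z)} + h(z)² e^{−H z})`. -/
theorem abs_involAccept_comp_mul_le (H : X → ℝ) (Ψ : X → X) (g h : X → ℝ) (z : X) :
    |involAccept H Ψ z * g (Ψ z) * h z * Real.exp (-H z)|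
      ≤ (1 / 2) * (g (Ψ z) ^ 2 * Real.exp (-H (Ψ z)) + h z ^ 2 * Real.exp (-H z)) := by
  have ha0 := involAccept_nonneg H Ψ z
  have ha1 := involAccept_le_one H Ψ z
  have hw0 : 0 ≤ Real.exp (-H z) := (Real.exp_pos _).le
  have hdom := involAccept_mul_exp_neg_le H Ψ z  -- a e^{-H z} ≤ e^{-H (Ψ z)}
  rw [abs_mul, abs_mul, abs_mul, abs_of_nonneg ha0, abs_of_nonneg hw0]
  have hg2 : 0 ≤ g (Ψ z) ^ 2 := sq_nonneg _
  have hh2 : 0 ≤ h z ^ 2 := sq_nonneg _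
  -- 2|g||h| a w ≤ g² a w + h² a w ≤ g² e^{-HΨ} + h² w
  have h1 : 2 * (|g (Ψ z)| * |h z|) ≤ g (Ψ z) ^ 2 + h z ^ 2 := by
    nlinarith [sq_nonneg (|g (Ψ z)| - |h z|), sq_abs (g (Ψ z)), sq_abs (h z)]
  have h2 : g (Ψ z) ^ 2 * (involAccept H Ψ z * Real.exp (-H z)) ≤ g (Ψ z) ^ 2 * Real.exp (-H (Ψ z)) :=
    mul_le_mul_of_nonneg_left hdom hg2
  have h3 : h z ^ 2 * (involAccept H Ψ z * Real.exp (-H z)) ≤ h z ^ 2 * Real.exp (-H z) := by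
    calc h z ^ 2 * (involAccept H Ψ z * Real.exp (-H z)) ≤ h z ^ 2 * (1 * Real.exp (-H z)) :=
          mul_le_mul_of_nonneg_left (mul_le_mul_of_nonneg_right ha1 hw0) hh2
      _ = h z ^ 2 * Real.exp (-H z) := by rw [one_mul]
  have haw : 0 ≤ involAccept H Ψ z * Real.exp (-H z) := mul_nonneg ha0 hw0
  nlinarith [mul_le_mul_of_nonneg_right h1 haw]

/-- The move term `a (g∘Ψ) h e^{−H}` is integrable when `g² e^{−H}` and `h² e^{−H}` are. -/
theorem integrable_involAccept_comp_mul_mul {H : X → ℝ} {Ψ : X → X} (hH : Measurable H)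
    (hΨm : Measurable Ψ) (hΨμ : MeasurePreserving Ψ μ μ) {g h : X → ℝ} (hgm : Measurable g)
    (hhm : Measurable h) (hg2 : Integrable (fun z => g z ^ 2 * Real.exp (-H z)) μ)
    (hh2 : Integrable (fun z => h z ^ 2 * Real.exp (-H z)) μ) :
    Integrable (fun z => involAccept H Ψ z * g (Ψ z) * h z * Real.exp (-H z)) μ := by
  have hg2Ψ : Integrable (fun z => g (Ψ z) ^ 2 * Real.exp (-H (Ψ z))) μ :=
    (hΨμ.integrable_comp hg2.aestronglyMeasurable).mpr hg2
  have hR : Integrable (fun z => (1 / 2) * (g (Ψ z) ^ 2 * Real.exp (-H (Ψ z))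
      + h z ^ 2 * Real.exp (-H z))) μ := (hg2Ψ.add hh2).const_mul (1 / 2)
  refine Integrable.mono' hR
    ((((measurable_involAccept hH hΨm).mul (hgm.comp hΨm)).mul hhm).mul
      (Real.measurable_exp.comp hH.neg)).aestronglyMeasurable
    (Eventually.of_forall fun z => ?_)
  rw [Real.norm_eq_abs]
  exact abs_involAccept_comp_mul_le H Ψ g h z

/-- The stay term `(1 − a) g h e^{−H}` is integrable when `g² e^{−H}` and `h² e^{−H}` are. -/
theorem integrable_one_sub_involAccept_mul_mul {H : X → ℝ} {Ψ : X → X} (hH : Measurable H)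
    (hΨm : Measurable Ψ) {g h : X → ℝ} (hgm : Measurable g) (hhm : Measurable h)
    (hg2 : Integrable (fun z => g z ^ 2 * Real.exp (-H z)) μ)
    (hh2 : Integrable (fun z => h z ^ 2 * Real.exp (-H z)) μ) :
    Integrable (fun z => (1 - involAccept H Ψ z) * g z * h z * Real.exp (-H z)) μ := by
  have hR : Integrable (fun z => (1 / 2) * (g z ^ 2 * Real.exp (-H z) + h z ^ 2 * Real.exp (-H z))) μ :=
    (hg2.add hh2).const_mul (1 / 2)
  refine Integrable.mono' hR
    ((((measurable_const.sub (measurable_involAccept hH hΨm)).mul hgm).mul hhm).mul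
      (Real.measurable_exp.comp hH.neg)).aestronglyMeasurable
    (Eventually.of_forall fun z => ?_)
  have ha0 := involAccept_nonneg H Ψ z
  have ha1 := involAccept_le_one H Ψ z
  have hw0 : 0 ≤ Real.exp (-H z) := (Real.exp_pos _).le
  rw [Real.norm_eq_abs, abs_mul, abs_mul, abs_mul, abs_of_nonneg (sub_nonneg.2 ha1), abs_of_nonneg hw0]
  have h1 : 2 * (|g z| * |h z|) ≤ g z ^ 2 + h z ^ 2 := by
    nlinarith [sq_nonneg (|g z| - |h z|), sq_abs (g z), sq_abs (h z)]
  have h01 : 0 ≤ 1 - involAccept H Ψ z := sub_nonneg.2 ha1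
  have hle1 : 1 - involAccept H Ψ z ≤ 1 := by linarith
  nlinarith [mul_le_mul_of_nonneg_right hle1 (mul_nonneg (mul_nonneg (abs_nonneg (g z)) (abs_nonneg (h z))) hw0),
    mul_nonneg (mul_nonneg (abs_nonneg (g z)) (abs_nonneg (h z))) hw0]

/-- **`involOp` IS SELF-ADJOINT ON SQUARE-INTEGRABLE OBSERVABLES**: for a measurable
`μ`-preserving involution `Ψ`, measurable `H`, and measurable `g`, `h` with `g² e^{−H}`,
`h² e^{−H}` integrable: `∫ (involOp H Ψ g) h e^{−H} dμ = ∫ g (involOp H Ψ h) e^{−H} dμ`. -/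
theorem involOp_symm_sq {H : X → ℝ} {Ψ : X → X} (hH : Measurable H) (hΨm : Measurable Ψ)
    (hΨi : Function.Involutive Ψ) (hΨμ : MeasurePreserving Ψ μ μ) {g h : X → ℝ}
    (hgm : Measurable g) (hhm : Measurable h)
    (hg2 : Integrable (fun z => g z ^ 2 * Real.exp (-H z)) μ)
    (hh2 : Integrable (fun z => h z ^ 2 * Real.exp (-H z)) μ) :
    ∫ z, involOp H Ψ g z * h z * Real.exp (-H z) ∂μ
      = ∫ z, g z * involOp H Ψ h z * Real.exp (-H z) ∂μ := by
  have hA := integrable_involAccept_comp_mul_mul hH hΨm hΨμ hgm hhm hg2 hh2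
  have hA' := integrable_involAccept_comp_mul_mul hH hΨm hΨμ hhm hgm hh2 hg2
  have hB := integrable_one_sub_involAccept_mul_mul hH hΨm hgm hhm hg2 hh2
  have e1 : ∀ z, involOp H Ψ g z * h z * Real.exp (-H z)
      = involAccept H Ψ z * g (Ψ z) * h z * Real.exp (-H z)
        + (1 - involAccept H Ψ z) * g z * h z * Real.exp (-H z) := fun z => by
    simp only [involOp]; ring
  have e2 : ∀ z, g z * involOp H Ψ h z * Real.exp (-H z)
      = involAccept H Ψ z * h (Ψ z) * g z * Real.exp (-H z)
        + (1 - involAccept H Ψ z) * g z * h z * Real.exp (-H z) := fun z => by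
    simp only [involOp]; ring
  simp_rw [e1, e2]
  rw [integral_add hA hB, integral_add hA' hB, integral_involAccept_comp_mul_symm hΨm hΨi hΨμ g h]
  congr 1
  refine integral_congr_ae (Eventually.of_forall fun z => ?_)
  dsimp only
  ring

end General

/-! ## (symm) and (contr) on `PolyObs`, and the floors for `S` and `M` themselves -/

section Lattice

variable {n : ℕ}

/-- Squares of polynomial-envelope observables, lifted to phase space, are `e^{−H}`-integrable. -/
theorem integrable_sq_fst_mul_exp_neg {J : Fin (n + 1) → Fin (n + 1) → ℝ} {lam ε K : ℝ}
    (hε : 0 < ε) (hS : ∀ φ : Fin (n + 1) → ℝ, ε * ∑ w, φ w ^ 2 - K ≤ latticePhi4Action J lam φ)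
    {f : (Fin (n + 1) → ℝ) → ℝ} (hf : PolyObs f) :
    Integrable (fun z : (Fin (n + 1) → ℝ) × (Fin (n + 1) → ℝ) =>
      f z.1 ^ 2 * Real.exp (-phi4HmcEnergy J lam z)) ((volume : Measure (Fin (n + 1) → ℝ)).prod volume) := by
  have h := (polyObs_integrable_mul_mul_gibbsWeight hε hS hf hf).mul_prod
    (integrable_momentumWeight (n := n))
  refine h.congr (Eventually.of_forall fun z => ?_)
  simp only [exp_neg_phi4HmcEnergy, sq]
  ring

/-- **The pairing through phase space** for polynomial-envelope `f`, `h`: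
`∫ (K_Ψ f) h e^{−S} = Z_p⁻¹ ∫∫ (involOp H Ψ (f∘fst)) (h∘fst) e^{−H}`. -/
theorem hmcOpOf_pairing_poly {J : Fin (n + 1) → Fin (n + 1) → ℝ} {lam ε K : ℝ} (hε : 0 < ε)
    (hS : ∀ φ : Fin (n + 1) → ℝ, ε * ∑ w, φ w ^ 2 - K ≤ latticePhi4Action J lam φ)
    {Ψ : (Fin (n + 1) → ℝ) × (Fin (n + 1) → ℝ) → (Fin (n + 1) → ℝ) × (Fin (n + 1) → ℝ)}
    (hΨm : Measurable Ψ) (hΨμ : MeasurePreserving Ψ ((volume : Measure (Fin (n + 1) → ℝ)).prod volume)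
      ((volume : Measure (Fin (n + 1) → ℝ)).prod volume))
    {f h : (Fin (n + 1) → ℝ) → ℝ} (hf : PolyObs f) (hh : PolyObs h) :
    ∫ φ, hmcOpOf J lam Ψ f φ * h φ * gibbsWeight J lam φ
      = (∫ z, involOp (phi4HmcEnergy J lam) Ψ (fun y => f y.1) z * h z.1
          * Real.exp (-phi4HmcEnergy J lam z)
            ∂((volume : Measure (Fin (n + 1) → ℝ)).prod volume)) / momentumZ n := by
  set H := phi4HmcEnergy J lam with hH
  set F : (Fin (n + 1) → ℝ) × (Fin (n + 1) → ℝ) → ℝ := fun y => f y.1 with hF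
  have hHm : Measurable H := measurable_phi4HmcEnergy J lam
  have hFm : Measurable F := hf.1.comp measurable_fst
  have hhm' : Measurable fun z : (Fin (n + 1) → ℝ) × (Fin (n + 1) → ℝ) => h z.1 :=
    hh.1.comp measurable_fst
  have hW : ∀ φ p, Real.exp (-H (φ, p)) = gibbsWeight J lam φ * momentumWeight p :=
    fun φ p => exp_neg_phi4HmcEnergy J lam (φ, p)
  -- integrability of the phase-space integrand (AM–GM majorants)
  have hf2 := integrable_sq_fst_mul_exp_neg hε hS hf
  have hh2 := integrable_sq_fst_mul_exp_neg hε hS hh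
  have hint : Integrable (fun z => involOp H Ψ F z * h z.1 * Real.exp (-H z))
      ((volume : Measure (Fin (n + 1) → ℝ)).prod volume) := by
    have hA := integrable_involAccept_comp_mul_mul (μ := (volume : Measure (Fin (n + 1) → ℝ)).prod volume)
      hHm hΨm hΨμ hFm hhm' hf2 hh2
    have hB := integrable_one_sub_involAccept_mul_mul (μ := (volume : Measure (Fin (n + 1) → ℝ)).prod volume)
      (Ψ := Ψ) hHm hΨm hFm hhm' hf2 hh2
    refine (hA.add hB).congr (Eventually.of_forall fun z => ?_)
    simp only [involOp, hF, Pi.add_apply]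
    ring
  have hop : ∀ φ, hmcOpOf J lam Ψ f φ
      = (∫ p, involOp H Ψ F (φ, p) * momentumWeight p) / momentumZ n := fun φ => rfl
  have hfub : ∫ φ, (∫ p, involOp H Ψ F (φ, p) * momentumWeight p) * h φ * gibbsWeight J lam φ
      = ∫ z, involOp H Ψ F z * h z.1 * Real.exp (-H z)
          ∂((volume : Measure (Fin (n + 1) → ℝ)).prod volume) := by
    rw [integral_prod _ hint]
    refine integral_congr_ae (Eventually.of_forall fun φ => ?_)
    dsimp only
    rw [mul_assoc, ← integral_mul_const]
    refine integral_congr_ae (Eventually.of_forall fun p => ?_)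
    dsimp only
    rw [hW φ p]
    ring
  calc ∫ φ, hmcOpOf J lam Ψ f φ * h φ * gibbsWeight J lam φ
      = ∫ φ, ((∫ p, involOp H Ψ F (φ, p) * momentumWeight p) * h φ * gibbsWeight J lam φ)
          / momentumZ n := by
        refine integral_congr_ae (Eventually.of_forall fun φ => ?_)
        dsimp only
        rw [hop]
        ring
    _ = (∫ z, involOp H Ψ F z * h z.1 * Real.exp (-H z)
          ∂((volume : Measure (Fin (n + 1) → ℝ)).prod volume)) / momentumZ n := by
        rw [integral_div, hfub]

/-- **(symm) THE HMC-TYPE UPDATE IS REVERSIBLE ON `PolyObs`** (coercive action, `Ψ` ANY measurable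
Lebesgue-preserving involution — no growth hypothesis): `∫ (K f) h e^{−S} = ∫ f (K h) e^{−S}`. -/
theorem hmc_reversible_poly {J : Fin (n + 1) → Fin (n + 1) → ℝ} {lam ε K : ℝ} (hε : 0 < ε)
    (hS : ∀ φ : Fin (n + 1) → ℝ, ε * ∑ w, φ w ^ 2 - K ≤ latticePhi4Action J lam φ)
    {Ψ : (Fin (n + 1) → ℝ) × (Fin (n + 1) → ℝ) → (Fin (n + 1) → ℝ) × (Fin (n + 1) → ℝ)}
    (hΨm : Measurable Ψ) (hΨi : Function.Involutive Ψ)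
    (hΨμ : MeasurePreserving Ψ ((volume : Measure (Fin (n + 1) → ℝ)).prod volume)
      ((volume : Measure (Fin (n + 1) → ℝ)).prod volume))
    {f h : (Fin (n + 1) → ℝ) → ℝ} (hf : PolyObs f) (hh : PolyObs h) :
    ∫ φ, hmcOpOf J lam Ψ f φ * h φ * gibbsWeight J lam φ
      = ∫ φ, f φ * hmcOpOf J lam Ψ h φ * gibbsWeight J lam φ := by
  have hHm : Measurable (phi4HmcEnergy J lam) := measurable_phi4HmcEnergy J lam
  have hsym := involOp_symm_sq (μ := (volume : Measure (Fin (n + 1) → ℝ)).prod volume) hHm hΨm hΨi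
    hΨμ (g := fun y : (Fin (n + 1) → ℝ) × (Fin (n + 1) → ℝ) => f y.1)
    (h := fun y : (Fin (n + 1) → ℝ) × (Fin (n + 1) → ℝ) => h y.1)
    (hf.1.comp measurable_fst) (hh.1.comp measurable_fst)
    (integrable_sq_fst_mul_exp_neg hε hS hf) (integrable_sq_fst_mul_exp_neg hε hS hh)
  have hrhs : ∫ φ, f φ * hmcOpOf J lam Ψ h φ * gibbsWeight J lam φ
      = ∫ φ, hmcOpOf J lam Ψ h φ * f φ * gibbsWeight J lam φ := by
    refine integral_congr_ae (Eventually.of_forall fun φ => ?_)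
    dsimp only
    ring
  rw [hrhs, hmcOpOf_pairing_poly hε hS hΨm hΨμ hf hh, hmcOpOf_pairing_poly hε hS hΨm hΨμ hh hf]
  congr 1
  rw [hsym]
  refine integral_congr_ae (Eventually.of_forall fun z => ?_)
  dsimp only
  ring

/-- **Cauchy–Schwarz against the momentum law** for square-integrable `u`:
`(∫ u e^{−½Σp²})² ≤ Z_p ∫ u² e^{−½Σp²}`. -/
theorem sq_integral_le_of_sq_integrable {u : (Fin (n + 1) → ℝ) → ℝ} (hum : Measurable u)
    (hu2 : Integrable (fun p => u p ^ 2 * momentumWeight p)) :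
    (∫ p, u p * momentumWeight p) ^ 2 ≤ momentumZ n * ∫ p, u p ^ 2 * momentumWeight p := by
  -- the class `A v := Measurable v ∧ v² mw ∈ L¹` satisfies (int) by AM–GM
  have hAi : ∀ ⦃f h : (Fin (n + 1) → ℝ) → ℝ⦄,
      (Measurable f ∧ Integrable (fun p => f p ^ 2 * momentumWeight p)) →
      (Measurable h ∧ Integrable (fun p => h p ^ 2 * momentumWeight p)) →
      Integrable (fun p => f p * h p * momentumWeight p) := by
    intro f h hf hh
    have hR : Integrable (fun p => (1 / 2) * (f p ^ 2 * momentumWeight p + h p ^ 2 * momentumWeight p)) :=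
      (hf.2.add hh.2).const_mul (1 / 2)
    refine Integrable.mono' hR
      ((hf.1.mul hh.1).mul measurable_momentumWeight).aestronglyMeasurable
      (Eventually.of_forall fun p => ?_)
    have hw0 : 0 ≤ momentumWeight p := (momentumWeight_pos p).le
    rw [Real.norm_eq_abs, abs_mul, abs_mul, abs_of_nonneg hw0]
    nlinarith [sq_nonneg (|f p| - |h p|), sq_abs (f p), sq_abs (h p),
      mul_nonneg (mul_nonneg (abs_nonneg (f p)) (abs_nonneg (h p))) hw0]
  have h1 : Measurable (fun _ : Fin (n + 1) → ℝ => (1 : ℝ))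
      ∧ Integrable (fun p : Fin (n + 1) → ℝ => (1 : ℝ) ^ 2 * momentumWeight p) :=
    ⟨measurable_const, by simpa using (integrable_momentumWeight (n := n))⟩
  have h := RevOp.sq_integral_mul_le (μ := (volume : Measure (Fin (n + 1) → ℝ)))
    (A := fun v => Measurable v ∧ Integrable (fun p => v p ^ 2 * momentumWeight p))
    (w := momentumWeight) (fun p => (momentumWeight_pos p).le) hAi ⟨hum, hu2⟩ h1
  simp only [mul_one, one_pow, one_mul] at h
  rw [mul_comm]
  exact h

/-- **Pointwise Jensen on `PolyObs`**: `(K_Ψ f)(φ)² ≤ (K_Ψ f²)(φ)` (growth hypothesis on `Ψ`). -/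
theorem hmcOpOf_sq_le_poly (J : Fin (n + 1) → Fin (n + 1) → ℝ) (lam : ℝ)
    {Ψ : (Fin (n + 1) → ℝ) × (Fin (n + 1) → ℝ) → (Fin (n + 1) → ℝ) × (Fin (n + 1) → ℝ)}
    (hΨm : Measurable Ψ) {C : ℝ} {m : ℕ} (hC : 0 ≤ C)
    (hΨg : ∀ z, phaseSize (Ψ z) ≤ C * phaseSize z ^ m)
    {f : (Fin (n + 1) → ℝ) → ℝ} (hf : PolyObs f) (φ : Fin (n + 1) → ℝ) :
    hmcOpOf J lam Ψ f φ ^ 2 ≤ hmcOpOf J lam Ψ (fun s => f s ^ 2) φ := by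
  have hZ := momentumZ_pos n
  have hHm := measurable_phi4HmcEnergy J lam
  obtain ⟨hfm, B, k, hfb⟩ := hf
  have hfb' := abs_le_abs_mul_env hfb
  have ha : Measurable fun p : Fin (n + 1) → ℝ => involAccept (phi4HmcEnergy J lam) Ψ (φ, p) :=
    (measurable_involAccept hHm hΨm).comp (measurable_const.prodMk measurable_id)
  set u : (Fin (n + 1) → ℝ) → ℝ := fun p => involAccept (phi4HmcEnergy J lam) Ψ (φ, p) * f (Ψ (φ, p)).1
    + (1 - involAccept (phi4HmcEnergy J lam) Ψ (φ, p)) * f φ with hu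
  have hum : Measurable u :=
    (ha.mul (hfm.comp (measurable_fst.comp (hΨm.comp (measurable_const.prodMk measurable_id))))).add
      ((measurable_const.sub ha).mul measurable_const)
  -- `u² mw` is integrable: `|u| ≤ A env(p)^K`
  set K' := m * k + k with hK'
  set A : ℝ := |B| * (C ^ k + 1) * (1 + ∑ w, φ w ^ 2) ^ K' with hA
  have hA0 : 0 ≤ A := by positivity
  have hub : ∀ p, |u p| ≤ A * (1 + ∑ w, p w ^ 2) ^ K' := fun p => by
    have h := hmcOpOf_integrand_abs_le_poly J lam hC hΨg (abs_nonneg B) hfb' (φ, p)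
    rw [hA]
    calc |u p| ≤ |B| * (C ^ k + 1) * ((1 + ∑ w, φ w ^ 2) ^ K' * (1 + ∑ w, p w ^ 2) ^ K') := h
      _ = |B| * (C ^ k + 1) * (1 + ∑ w, φ w ^ 2) ^ K' * (1 + ∑ w, p w ^ 2) ^ K' := by ring
  have hu2 : Integrable (fun p => u p ^ 2 * momentumWeight p) := by
    refine Integrable.mono' ((integrable_env_pow_mul_momentumWeight (n := n) (K' + K')).const_mul (A ^ 2))
      ((hum.pow_const 2).mul measurable_momentumWeight).aestronglyMeasurable
      (Eventually.of_forall fun p => ?_)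
    have hw0 : 0 ≤ momentumWeight p := (momentumWeight_pos p).le
    rw [Real.norm_eq_abs, abs_mul, abs_of_nonneg (sq_nonneg _), abs_of_nonneg hw0, pow_add]
    have hsq : u p ^ 2 ≤ (A * (1 + ∑ w, p w ^ 2) ^ K') ^ 2 := by
      rw [← sq_abs]
      exact pow_le_pow_left₀ (abs_nonneg _) (hub p) 2
    calc u p ^ 2 * momentumWeight p ≤ (A * (1 + ∑ w, p w ^ 2) ^ K') ^ 2 * momentumWeight p :=
          mul_le_mul_of_nonneg_right hsq hw0
      _ = A ^ 2 * ((1 + ∑ w, p w ^ 2) ^ K' * (1 + ∑ w, p w ^ 2) ^ K' * momentumWeight p) := by ring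
  have hCS := sq_integral_le_of_sq_integrable hum hu2
  have e1 : hmcOpOf J lam Ψ f φ = (∫ p, u p * momentumWeight p) / momentumZ n := rfl
  -- convexity under accept/reject: `u² ≤ a f'² + (1−a) f²`
  have hI2 := integrable_hmcOpOf_integrand_poly J lam hΨm hC hΨg
    (polyObs_sq ⟨hfm, B, k, hfb⟩) φ
  have hstep : ∫ p, u p ^ 2 * momentumWeight p
      ≤ ∫ p, (involAccept (phi4HmcEnergy J lam) Ψ (φ, p) * (fun s => f s ^ 2) (Ψ (φ, p)).1
          + (1 - involAccept (phi4HmcEnergy J lam) Ψ (φ, p)) * (fun s => f s ^ 2) φ)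
          * momentumWeight p := by
    refine integral_mono hu2 hI2 fun p => ?_
    have ha0 := involAccept_nonneg (phi4HmcEnergy J lam) Ψ (φ, p)
    have ha1 := involAccept_le_one (phi4HmcEnergy J lam) Ψ (φ, p)
    dsimp only
    have hcx : (involAccept (phi4HmcEnergy J lam) Ψ (φ, p) * f (Ψ (φ, p)).1
        + (1 - involAccept (phi4HmcEnergy J lam) Ψ (φ, p)) * f φ) ^ 2
        ≤ involAccept (phi4HmcEnergy J lam) Ψ (φ, p) * f (Ψ (φ, p)).1 ^ 2
          + (1 - involAccept (phi4HmcEnergy J lam) Ψ (φ, p)) * f φ ^ 2 := by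
      nlinarith [mul_nonneg (mul_nonneg ha0 (sub_nonneg.2 ha1)) (sq_nonneg (f (Ψ (φ, p)).1 - f φ))]
    exact mul_le_mul_of_nonneg_right hcx (momentumWeight_pos _).le
  calc hmcOpOf J lam Ψ f φ ^ 2 = (∫ p, u p * momentumWeight p) ^ 2 / momentumZ n ^ 2 := by
        rw [e1, div_pow]
    _ ≤ (momentumZ n * ∫ p, u p ^ 2 * momentumWeight p) / momentumZ n ^ 2 :=
        div_le_div_of_nonneg_right hCS (sq_nonneg _)
    _ = (∫ p, u p ^ 2 * momentumWeight p) / momentumZ n := by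
        field_simp
    _ ≤ (∫ p, (involAccept (phi4HmcEnergy J lam) Ψ (φ, p) * (fun s => f s ^ 2) (Ψ (φ, p)).1
          + (1 - involAccept (phi4HmcEnergy J lam) Ψ (φ, p)) * (fun s => f s ^ 2) φ)
          * momentumWeight p) / momentumZ n := div_le_div_of_nonneg_right hstep hZ.le
    _ = hmcOpOf J lam Ψ (fun s => f s ^ 2) φ := rfl

/-- **(contr) THE HMC-TYPE UPDATE IS AN `L²(e^{−S})` CONTRACTION ON `PolyObs`**:
`∫ (K_Ψ f)² e^{−S} ≤ ∫ f² e^{−S}` (coercive action, involution of polynomial growth). -/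
theorem hmcOpOf_contraction_poly {J : Fin (n + 1) → Fin (n + 1) → ℝ} {lam ε K : ℝ} (hε : 0 < ε)
    (hS : ∀ φ : Fin (n + 1) → ℝ, ε * ∑ w, φ w ^ 2 - K ≤ latticePhi4Action J lam φ)
    {Ψ : (Fin (n + 1) → ℝ) × (Fin (n + 1) → ℝ) → (Fin (n + 1) → ℝ) × (Fin (n + 1) → ℝ)}
    (hΨm : Measurable Ψ) (hΨi : Function.Involutive Ψ)
    (hΨμ : MeasurePreserving Ψ ((volume : Measure (Fin (n + 1) → ℝ)).prod volume)
      ((volume : Measure (Fin (n + 1) → ℝ)).prod volume))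
    {C : ℝ} {m : ℕ} (hC : 0 ≤ C) (hΨg : ∀ z, phaseSize (Ψ z) ≤ C * phaseSize z ^ m)
    {f : (Fin (n + 1) → ℝ) → ℝ} (hf : PolyObs f) :
    ∫ φ, hmcOpOf J lam Ψ f φ ^ 2 * gibbsWeight J lam φ ≤ ∫ φ, f φ ^ 2 * gibbsWeight J lam φ := by
  have hf2 : PolyObs (fun s => f s ^ 2) := polyObs_sq hf
  have hf2w : Integrable (fun φ => f φ ^ 2 * gibbsWeight J lam φ) :=
    (polyObs_integrable_mul_mul_gibbsWeight hε hS hf hf).congr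
      (Eventually.of_forall fun φ => by simp only [sq])
  have hex := hmc_exact_of_involutive (J := J) (lam := lam) hΨm hΨi hΨμ hf2.1 hf2w
  rw [← hex]
  have hKf := polyObs_hmcOpOf J lam hΨm hC hΨg hf
  have hKf2 := polyObs_hmcOpOf J lam hΨm hC hΨg hf2
  have hL : Integrable (fun φ => hmcOpOf J lam Ψ f φ ^ 2 * gibbsWeight J lam φ) :=
    (polyObs_integrable_mul_mul_gibbsWeight hε hS hKf hKf).congr
      (Eventually.of_forall fun φ => by simp only [sq])
  have hR : Integrable (fun φ => hmcOpOf J lam Ψ (fun s => f s ^ 2) φ * gibbsWeight J lam φ) := by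
    have h := polyObs_integrable_mul_mul_gibbsWeight hε hS hKf2 (polyObs_const 1)
    exact h.congr (Eventually.of_forall fun φ => by simp only [mul_one])
  exact integral_mono hL hR fun φ =>
    mul_le_mul_of_nonneg_right (hmcOpOf_sq_le_poly J lam hΨm hC hΨg hf φ) (gibbsWeight_pos J lam φ).le

end Lattice

end Summit.Ventures.LatticeQCDFlow.Exactness
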